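import Literature.Computability.AlgebraicComplexity.DDS21ResidueChainExists
import Literature.Computability.AlgebraicComplexity.DDS21TranscriptInstantiation
import HarnessLib

/-!
# Dutta–Dwivedi–Saxena 2021, Theorem 3.2 BY NAME: `DDS2021_thm_3_2_holds`

Theorem-only file (cell `val-lit`, np lane, DDS21 Thm 3.2 programme "M-b"; lead-np RULINGS
(164)(e)/(167)(c): the composer of the one-liner is p1 g10). Source: P. Dutta, P. Dwivedi,
N. Saxena, *Demystifying the border of depth-3 algebraic circuits*, FOCS 2021, full version
`paper:galaxy-pdf-7641649743695546420`, Thm. 3.2 (p0026 L713–715) with its proof §3 (p0026 L716 –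
p0036 L962) [DuttaDwivediSaxena2022].

## What is proved

`DDS2021_thm_3_2_holds : DDS2021_thm_3_2` — the tree's named statement of Thm. 3.2
(`DDS21BorderDepthThree.lean`): there is an absolute constant `c` such that over every field `F` of
characteristic `0`, every `n`-variate `f ∈ \overline{Σ^{[k]}Π^{[d]}Σ}` (border of depth-3 top fan-in
`k`, `k, d, n ≤ s`, `2 ≤ s`) is computed by an algebraic branching program with univariate edge
labels of size `s ^ (c · k · 7 ^ k)`.

The proof is the ONE-LINE composition of the two halves of the cell's rendering of §3:

* `DDS2021.residueChain_exists` (`DDS21ResidueChainExists.lean`, x5 g8) — the `F′(x)`-side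
  RESIDUE CHAIN of the DiDIL induction at the generic point `y` of `F′ = Frac F[y]` (architecture
  `(A′)`): base change and shift of the input (`DDS21BorderBaseChange`, `DDS21TranscriptResidues`
  §1, `ε`-regularity `DDS21GenericShiftRegular`/`DDS21StageZeroRegularForms`), the run on brick
  B4b's exact objects (`DDS21DiDILStep`, `DDS21DiDILExactChain`, `DDS21TranscriptResidues` §2), the
  divisor pairs and the end pair with programs (`DDS21DiDILEndGame`, Claim 3.3), their graded
  valuations (`DDS21DiDILCompanion`, induction hypothesis (3)), the Claim-3.8 slice programs
  (`DDS21SliceZeroPrograms`), and the budget closing (`DDS21TranscriptBudget`,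
  `DDS21CertTowerBudget`);
* `DDS2021.DDS2021_thm_3_2_of_residueChain` (`DDS21TranscriptInstantiation.lean`, p1 g10) — the
  `z`-frame conversion of that chain (dilation `DDS21TranscriptDilation`, link lemma, slice bridge
  `DDS21DilationGradeZero`), the trace-back with the TOP seam (`DDS21TraceBackStep/FinalStep/
  Assembly`, Claims 3.7/3.8 "definite integration"), the stage budget (`DDS21SizeTower`,
  `DDS21Thm32Assembly`) and the descent from `F′` to `F` (`UABPDescent`).

No definitions, no named facts (census +0: `DDS2021_thm_3_2` is an x-row fact DISCHARGED BY NAME).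
Honest framing: this closes the tree's statement of a PUBLISHED 2021 theorem (de-bordering
`Σ^{[k]}ΠΣ` into VBP for constant `k`); it says nothing about VP versus VNP, which is NOT proved,
and rung V4 of the cell's ladder is untouched.

## References

* [DuttaDwivediSaxena2022] P. Dutta, P. Dwivedi, N. Saxena, *Demystifying the border of depth-3
  algebraic circuits*, Proc. 62nd FOCS (2021), IEEE 2022, 92–103; full version Thm. 3.2
  (p0026 L713–715), §3 proof (p0026 L716 – p0036 L962), Claims 3.3–3.8.
-/

noncomputable section

namespace Literature.Computability.AlgebraicComplexity

/-- **Dutta–Dwivedi–Saxena 2021, Theorem 3.2** (`\overline{Σ^{[k]}ΠΣ} ⊆ VBP` with size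
`s ^ (c·k·7^k)`), the tree's named statement `DDS2021_thm_3_2`, PROVED: the residue chain of the
DiDIL induction at the generic point (`DDS2021.residueChain_exists`) fed to the `z`-frame
trace-back-and-descent reduction (`DDS2021.DDS2021_thm_3_2_of_residueChain`).
[cite: DuttaDwivediSaxena2022, Thm. 3.2 (full version p0026 L713–715) with proof §3 (p0026 L716 – p0036 L962)] -/
theorem DDS2021_thm_3_2_holds : DDS2021_thm_3_2 :=
  DDS2021.DDS2021_thm_3_2_of_residueChain DDS2021.residueChain_exists

end Literature.Computability.AlgebraicComplexity

end
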